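import Summits.QuantumFields.YangMills.Theorems.LuscherReductionTwistedTraceScalingFPWeightIntegrand
import HarnessLib

/-!
# Every near-vacuum configuration has a SLICE REPRESENTATIVE `tubePt p*` on its gauge orbit, with `‖p*‖ = O(√τ)`; the Faddeev–Popov weight is the same there
# (lane A of S-BASE, crux `TwistedTraceScaling` stmt-QuantumFields-20203, C4 INNER; design note `pub/ym-fleet/ym-luscher-20007-p1/COARSE-DESIGN.md` §23.12)

`fpWeight_explicit_bounds` (p638588) evaluates the Faddeev–Popov weight at a tube point `tubePt p*` ON THE SLICE.  THIS FILE supplies such a point on every orbit near the vacuum: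
* ★ `polarMean_near` — for `1 − τ ≤ scalarPart(U_e)` (all `e`, `τ ≤ 1/2`): `0 ≤ scalarPart(p_k)` and `‖vecPart(p_k)‖∞ ≤ 2√(2τ)`; `orthoTube_slowMean_chart` — `U = orthoTube (P∘c) v`
  with `c_k = vecPart(p_k)`, `v = ` the relative coordinates, `‖v_e‖∞ ≤ √(10τ)` (`…OrthoTubeCoverage`, `chartSU2_vecPart`);
* ★★ `exists_slice_tubePt` — for `τ` below an explicit threshold built from the constants `K, ε` of `exists_slicePoint` (p628969): there are a based parameter and a base point
  `p* = (v*, c*)` with `P_Γ(linkEmbed v*) = 0` (slice), `tubePt p* = U^{P∘ξ}` (same orbit: ★ N and `orbitDist` unchanged), `tubePt p* ∈ nearOne (2√τ + 8K√(10τ) + …)` and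
  `‖p*‖ = O((1 + K)√τ)`.
HONEST FRAMING: bookkeeping for a stub of a child of the CONDITIONAL reduction route R2b1; no spectral claim; C4 OPEN; not a gap, not Clay.
-/

set_option autoImplicit false

noncomputable section

open Real
open scoped BigOperators
open Literature.MathematicalPhysics.QuantumFieldTheory
open Literature.MathematicalPhysics.QuantumLattice

namespace Summit.QuantumFields.YangMills.Theorems.FemtoTransferGap.TwoLattice.ConstTube

open Summit.QuantumFields.YangMills.Theorems.FemtoTransferGap
open Summit.QuantumFields.YangMills.Theorems.FemtoTransferGap.TwoLattice.Avg
open Summit.QuantumFields.YangMills.Theorems.FemtoTransferGap.TwoLattice.Stiff (LinkSpace)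
open Literature.Algebra.EuclideanLattices (abs_apply_le_norm)

variable (L : ℕ) [NeZero L]

/-! ## §1 The polar mean of a near-vacuum configuration -/

/-- ★ For `1 − τ ≤ scalarPart(U_e)` (`0 ≤ τ ≤ 1/2`): the polar mean has nonnegative scalar part and `‖vecPart(p_k)‖∞ ≤ 2√(2τ)`. [folklore] -/
theorem polarMean_near {U : GaugeConfig 3 L SU2} {τ : ℝ} (hτ0 : 0 ≤ τ) (hτ : τ ≤ 1 / 2) (hU : ∀ e : Edge 3 L, 1 - τ ≤ scalarPart (U e)) (k : Fin 3) :
    0 ≤ scalarPart (polarMean L k U) ∧ ‖vecPart (polarMean L k U)‖ ≤ 2 * Real.sqrt (2 * τ) := by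
  set N : ℝ := (Fintype.card (Site 3 L) : ℝ) with hN
  have hNpos : 0 < N := by rw [hN]; exact_mod_cast Fintype.card_pos
  have hM0 : dirQuat L k U ≠ 0 := dirQuat_ne_zero_of_near (δ := τ) hU (by linarith) k
  obtain ⟨hs, hv⟩ := parts_polarMean L hM0
  have hS : N * (1 - τ) ≤ dirScalarSum L k U := dirScalarSum_ge hU k
  have hSpos : 0 < dirScalarSum L k U := lt_of_lt_of_le (by nlinarith) hS
  have hMge : dirScalarSum L k U ≤ ‖dirQuat L k U‖ := by
    rw [norm_dirQuat]
    calc dirScalarSum L k U = Real.sqrt (dirScalarSum L k U ^ 2) := (Real.sqrt_sq hSpos.le).symm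
      _ ≤ _ := Real.sqrt_le_sqrt (le_add_of_nonneg_right (Finset.sum_nonneg fun a _ => sq_nonneg _))
  have hMpos : 0 < ‖dirQuat L k U‖ := hSpos.trans_le hMge
  constructor
  · rw [hs]; positivity
  · rw [hv, norm_smul, norm_inv, norm_norm]
    have hV2 : ∑ a, dirVecSum L k U a ^ 2 ≤ 2 * τ * N ^ 2 := sum_dirVecSum_sq_le hτ0 hU k
    have hVa : ∀ a, |dirVecSum L k U a| ≤ Real.sqrt (2 * τ) * N := fun a => by
      have h1 : dirVecSum L k U a ^ 2 ≤ (Real.sqrt (2 * τ) * N) ^ 2 := by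
        rw [mul_pow, Real.sq_sqrt (by positivity)]
        exact (Finset.single_le_sum (fun b _ => sq_nonneg (dirVecSum L k U b)) (Finset.mem_univ a)).trans hV2
      exact abs_le_of_sq_le_sq' h1 (by positivity) |> fun h => abs_le.mpr ⟨h.1, h.2⟩
    have hVn : ‖dirVecSum L k U‖ ≤ Real.sqrt (2 * τ) * N :=
      (pi_norm_le_iff_of_nonneg (by positivity)).mpr fun a => by rw [Real.norm_eq_abs]; exact hVa a
    rw [inv_mul_le_iff₀ hMpos]
    calc ‖dirVecSum L k U‖ ≤ Real.sqrt (2 * τ) * N := hVn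
      _ ≤ Real.sqrt (2 * τ) * (2 * (N * (1 - τ))) := by
          apply mul_le_mul_of_nonneg_left _ (Real.sqrt_nonneg _); nlinarith
      _ ≤ ‖dirQuat L k U‖ * (2 * Real.sqrt (2 * τ)) := by nlinarith [Real.sqrt_nonneg (2 * τ)]

/-- ★ The orthographic chart of a near-vacuum configuration: `U = orthoTube (P∘c) v`, `c_k = vecPart p_k`, `v` the relative coordinates, with bounds. [folklore] -/
theorem orthoTube_slowMean_chart {U : GaugeConfig 3 L SU2} {τ : ℝ} (hτ0 : 0 ≤ τ) (hτ : τ ≤ 1 / 50) (hU : ∀ e : Edge 3 L, 1 - τ ≤ scalarPart (U e)) :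
    orthoTube L (fun e₁ => chartSU2 (vecPart (polarMean L e₁.2 U))) (fun e => vecPart (U e * (polarMean L e.2 U)⁻¹)) = U ∧
      (fun e => vecPart (U e * (polarMean L e.2 U)⁻¹)) ∈ balancedSet L ∧
      (∀ e, ‖vecPart (U e * (polarMean L e.2 U)⁻¹)‖ ≤ Real.sqrt (10 * τ)) ∧
      ∀ k, ‖vecPart (polarMean L k U)‖ ≤ 2 * Real.sqrt (2 * τ) := by
  obtain ⟨hrec, -, hcap, hsq⟩ := mem_orthoTubeSet_of_near_one L hτ0 hτ hU
  have hpm := fun k => polarMean_near L hτ0 (by linarith) hU k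
  have hchart : (fun e₁ : Edge 3 1 => chartSU2 (vecPart (polarMean L e₁.2 U))) = slowMean L U := by
    funext e₁; exact chartSU2_vecPart _ (hpm e₁.2).1
  refine ⟨by rw [hchart]; exact hrec, hcap.1, fun e => ?_, fun k => (hpm k).2⟩
  refine (pi_norm_le_iff_of_nonneg (Real.sqrt_nonneg _)).mpr fun a => ?_
  rw [Real.norm_eq_abs]
  have h1 : vecPart (U e * (polarMean L e.2 U)⁻¹) a ^ 2 ≤ Real.sqrt (10 * τ) ^ 2 := by
    rw [Real.sq_sqrt (by positivity)]
    exact (Finset.single_le_sum (fun b _ => sq_nonneg _) (Finset.mem_univ a)).trans (hsq e)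
  exact abs_le_of_sq_le_sq' h1 (Real.sqrt_nonneg _) |> fun h => abs_le.mpr ⟨h.1, h.2⟩

/-- Near the vacuum in Frobenius norm: `1 − τ ≤ scalarPart(U_e)` ⇒ `‖U_e − 1‖_F ≤ 2√τ`. [folklore] -/
theorem frobNorm_le_of_scalarPart_ge {W : SU2} {τ : ℝ} (hτ0 : 0 ≤ τ) (hW : 1 - τ ≤ scalarPart W) : frobNorm ((W : Matrix (Fin 2) (Fin 2) ℂ) - 1) ≤ 2 * Real.sqrt τ := by
  have h := frobNorm_sub_one_sq_eq_scalarPart W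
  have h1 : frobNorm ((W : Matrix (Fin 2) (Fin 2) ℂ) - 1) ^ 2 ≤ (2 * Real.sqrt τ) ^ 2 := by
    rw [h, mul_pow, Real.sq_sqrt hτ0]; linarith
  exact (abs_le_of_sq_le_sq' h1 (by positivity)).2

/-- Conversely `‖W − 1‖_F ≤ R` ⇒ `1 − R²/4 ≤ scalarPart W`. [folklore] -/
theorem scalarPart_ge_of_frobNorm_le {W : SU2} {R : ℝ} (hW : frobNorm ((W : Matrix (Fin 2) (Fin 2) ℂ) - 1) ≤ R) : 1 - R ^ 2 / 4 ≤ scalarPart W := by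
  have h := frobNorm_sub_one_sq_eq_scalarPart W
  have h0 := frobNorm_nonneg ((W : Matrix (Fin 2) (Fin 2) ℂ) - 1)
  have h1 : frobNorm ((W : Matrix (Fin 2) (Fin 2) ℂ) - 1) ^ 2 ≤ R ^ 2 := pow_le_pow_left₀ h0 hW 2
  nlinarith

/-! ## §2 ★★ The slice representative -/

/-- ★★ **EVERY NEAR-VACUUM ORBIT HAS A SLICE TUBE POINT.**  Let `K, ε` be the constants of `exists_slicePoint` (`ε` enters only through the hypotheses).  If `1 − τ ≤ scalarPart(U_e)` for all links with `τ` so small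
that `√(10τ) < ε`, `2√(2τ) < ε`, `K√(10τ) ≤ 1/2` and `τ' := (2√τ + 8K√(10τ))²/4 ≤ 1/50`, then some gauge transform `U' = U^{P∘ξ}` is a tube point `tubePt p*` on the slice,
with `1 − τ' ≤ scalarPart(U'_e)` and `‖p*‖ ≤ max (√(10τ')) (2√(2τ'))`. [folklore] -/
theorem exists_slice_tubePt {K ε : ℝ} (hK : 0 ≤ K)
    (hSP : ∀ w : Edge 3 L → Fin 3 → ℝ, w ∈ balancedSet L → ∀ c : Fin 3 → Fin 3 → ℝ, ‖w‖ < ε → ‖c‖ < ε →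
      ∃ ξ : Site 3 L → Fin 3 → ℝ, ∑ x : Site 3 L, ξ x = 0 ∧ ‖ξ‖ ≤ K * ‖w‖ ∧
        gaugeCoordSq L (gaugeTransform (fun x => chartSU2 (ξ x)) (orthoTube L (fun e₁ => chartSU2 (c e₁.2)) w)) = 0)
    {τ : ℝ} (hτ0 : 0 ≤ τ) (hτ : τ ≤ 1 / 50) (hτε1 : Real.sqrt (10 * τ) < ε) (hτε2 : 2 * Real.sqrt (2 * τ) < ε) (hτK : K * Real.sqrt (10 * τ) ≤ 1 / 2)
    (hτ' : (2 * Real.sqrt τ + 8 * (K * Real.sqrt (10 * τ))) ^ 2 / 4 ≤ 1 / 50)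
    {U : GaugeConfig 3 L SU2} (hU : ∀ e : Edge 3 L, 1 - τ ≤ scalarPart (U e)) :
    ∃ (ξ : Site 3 L → Fin 3 → ℝ) (p : balancedSubmodule L × (Fin 3 → Fin 3 → ℝ)),
      tubePt L p = gaugeTransform (fun x => chartSU2 (ξ x)) U ∧
      (gaugeModes L).starProjection (linkEmbed L (p.1 : Edge 3 L → Fin 3 → ℝ)) = 0 ∧
      (∀ e : Edge 3 L, 1 - (2 * Real.sqrt τ + 8 * (K * Real.sqrt (10 * τ))) ^ 2 / 4 ≤ scalarPart (tubePt L p e)) ∧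
      tubePt L p ∈ nearOne L (2 * Real.sqrt τ + 8 * (K * Real.sqrt (10 * τ)) + 1) ∧
      ‖p‖ ≤ max (Real.sqrt (10 * ((2 * Real.sqrt τ + 8 * (K * Real.sqrt (10 * τ))) ^ 2 / 4)))
        (2 * Real.sqrt (2 * ((2 * Real.sqrt τ + 8 * (K * Real.sqrt (10 * τ))) ^ 2 / 4))) := by
  -- chart at `U`
  obtain ⟨hrec, hbal, hv, hc⟩ := orthoTube_slowMean_chart L hτ0 hτ hU
  set v : Edge 3 L → Fin 3 → ℝ := fun e => vecPart (U e * (polarMean L e.2 U)⁻¹) with hvdef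
  set c : Fin 3 → Fin 3 → ℝ := fun k => vecPart (polarMean L k U) with hcdef
  have hvn : ‖v‖ ≤ Real.sqrt (10 * τ) := (pi_norm_le_iff_of_nonneg (Real.sqrt_nonneg _)).mpr hv
  have hcn : ‖c‖ ≤ 2 * Real.sqrt (2 * τ) := (pi_norm_le_iff_of_nonneg (by positivity)).mpr hc
  -- slice point on the orbit
  obtain ⟨ξ, -, hξK, hslice⟩ := hSP v hbal c (lt_of_le_of_lt hvn hτε1) (lt_of_le_of_lt hcn hτε2)
  have hξn : ∀ x, ‖ξ x‖ ≤ K * Real.sqrt (10 * τ) := fun x =>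
    (norm_le_pi_norm ξ x).trans (hξK.trans (mul_le_mul_of_nonneg_left hvn hK))
  set U' : GaugeConfig 3 L SU2 := gaugeTransform (fun x => chartSU2 (ξ x)) U with hU'
  have hUeq : orthoTube L (fun e₁ => chartSU2 (c e₁.2)) v = U := hrec
  have hslice' : gaugeCoordSq L U' = 0 := by rw [hU', ← hUeq]; exact hslice
  -- `U'` is near the vacuum
  set R : ℝ := 2 * Real.sqrt τ + 8 * (K * Real.sqrt (10 * τ)) with hR
  have hUnear : U ∈ nearOne L (2 * Real.sqrt τ + 1 / 2 ^ 20) := fun e =>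
    lt_of_le_of_lt (frobNorm_le_of_scalarPart_ge hτ0 (hU e)) (by norm_num)
  have hU'near : U' ∈ nearOne L (2 * Real.sqrt τ + 1 / 2 ^ 20 + 8 * (K * Real.sqrt (10 * τ))) :=
    gaugeTransform_chart_mem_nearOne L hUnear hξn (by linarith)
  have hU'frob : ∀ e : Edge 3 L, frobNorm (((U' e : SU2) : Matrix (Fin 2) (Fin 2) ℂ) - 1) ≤ R := fun e => by
    -- sharpen the `1/2^20` slack away: redo the estimate with the non-strict bounds
    have h1 := frobNorm_gaugeTransform_sub_one_le L (fun x => chartSU2 (ξ x)) U e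
    have h2 := frobNorm_chartSU2_sub_one_le ((hξn e.1).trans (by linarith))
    have h3 := frobNorm_chartSU2_sub_one_le ((hξn (e.1.shift e.2)).trans (by linarith))
    have h4 := frobNorm_le_of_scalarPart_ge hτ0 (hU e)
    have h5 := hξn e.1
    have h6 := hξn (e.1.shift e.2)
    rw [hR]; rw [hU']
    linarith
  set τ' : ℝ := R ^ 2 / 4 with hτ'def
  have hτ'0 : 0 ≤ τ' := by positivity
  have hU'sc : ∀ e : Edge 3 L, 1 - τ' ≤ scalarPart (U' e) := fun e => scalarPart_ge_of_frobNorm_le (hU'frob e)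
  -- chart at `U'`
  obtain ⟨hrec', hbal', hv', hc'⟩ := orthoTube_slowMean_chart L hτ'0 (by rw [hτ'def, hR]; exact hτ') hU'sc
  set v' : Edge 3 L → Fin 3 → ℝ := fun e => vecPart (U' e * (polarMean L e.2 U')⁻¹) with hv'def
  set c' : Fin 3 → Fin 3 → ℝ := fun k => vecPart (polarMean L k U') with hc'def
  refine ⟨ξ, (⟨v', hbal'⟩, c'), ?_, ?_, ?_, ?_, ?_⟩
  · -- `tubePt p* = U'`
    exact hrec'
  · -- slice: `linkEmbed v' = relLinkVec U'`
    have hle : linkEmbed L v' = relLinkVec L U' := by ext ea; rfl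
    rw [show ((⟨v', hbal'⟩ : balancedSubmodule L) : Edge 3 L → Fin 3 → ℝ) = v' from rfl, hle]
    have h0 : ‖(gaugeModes L).starProjection (relLinkVec L U')‖ ^ 2 = 0 := hslice'
    exact norm_eq_zero.mp (pow_eq_zero_iff two_ne_zero |>.mp h0)
  · intro e; rw [show tubePt L (⟨v', hbal'⟩, c') = U' from hrec']; exact hU'sc e
  · intro e; rw [show tubePt L (⟨v', hbal'⟩, c') = U' from hrec']
    exact lt_of_le_of_lt (hU'frob e) (by linarith)
  · rw [Prod.norm_def]
    refine max_le_max ?_ ?_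
    · rw [Submodule.coe_norm]; exact (pi_norm_le_iff_of_nonneg (Real.sqrt_nonneg _)).mpr hv'
    · exact (pi_norm_le_iff_of_nonneg (by positivity)).mpr hc'

/-- ★ **The Faddeev–Popov weight and the orbit distance are the same at the representative.** [folklore] -/
theorem gaugeAvg_tubePt_rep {δ ρ δg : ℝ → ℝ} {β : ℝ} {U : GaugeConfig 3 L SU2} {ξ : Site 3 L → Fin 3 → ℝ}
    {p : balancedSubmodule L × (Fin 3 → Fin 3 → ℝ)} (h : tubePt L p = gaugeTransform (fun x => chartSU2 (ξ x)) U) :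
    gaugeAvg (recordWeightRho L δ ρ δg β) (tubePt L p) = gaugeAvg (recordWeightRho L δ ρ δg β) U ∧ orbitDist (tubePt L p) = orbitDist U := by
  rw [h]
  exact ⟨gaugeAvg_recordWeightRho_gaugeTransform L δ ρ δg β _ U, orbitDist_gaugeTransform _ U⟩

end Summit.QuantumFields.YangMills.Theorems.FemtoTransferGap.TwoLattice.ConstTube

end
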